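import Mathlib
import HarnessLib
import Summits.HubbardSuperconductivity.HubbardSuperconductivity.Theses.ComplexGFFStiffness
import Summits.HubbardSuperconductivity.HubbardSuperconductivity.Theorems.ComplexGFFStiffnessHypACumulant
import Summits.HubbardSuperconductivity.HubbardSuperconductivity.Theorems.ComplexGFFStiffnessHypALocalTwoPoint

/-!
# Route `route-HubbardSuperconductivity-ComplexGFFStiffness`: the deciding (rung) theorem `ComplexGFF4Stiffness` HOLDS

The route's own `closes (h₁ : HypACumulant) (h₂ : HypALocalTwoPoint) : ComplexGFF4Stiffness` applied to the two landed cruxes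
`HypACumulant_proof` (stmt-HubbardSuperconductivity-19154) and `HypALocalTwoPoint_proof` (stmt-HubbardSuperconductivity-19155):
volume-uniform stiffness of the complex gradient `GFF⁴` model via the [ABKM19] renormalisation group (ladder Hubbard rung H2gff / 1c).

* **`ComplexGFF4Stiffness_proof`** — `Summit.….Theses.ComplexGFFStiffness.ComplexGFF4Stiffness` BY NAME.

All proved, no `sorry`.  Honest scope (D-0061): this is a RUNG route's deciding theorem, NOT the summit `Statement` — nothing about
superconductivity in the Hubbard model is claimed or advanced.

## References
* S. Adams, S. Buchholz, R. Kotecký, S. Müller, arXiv:1910.13564, Thm 2.2, Lemma 12.6 [AdamsBuchholzKoteckyMuller2019].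
-/

noncomputable section

-- `Summit.<Summit>.<Problem>`: single-conjunct summit, the duplicate component is mandated (D-0017).
set_option linter.dupNamespace false

namespace Summit.HubbardSuperconductivity.HubbardSuperconductivity.Theorems

/-- **The rung theorem `ComplexGFF4Stiffness` holds** (the route's `closes` on the two landed cruxes).
[cite: AdamsBuchholzKoteckyMuller2019, Thm 2.2 / Lemma 12.6] -/
theorem ComplexGFF4Stiffness_proof :
    Summit.HubbardSuperconductivity.HubbardSuperconductivity.Theses.ComplexGFFStiffness.ComplexGFF4Stiffness :=
  Summit.HubbardSuperconductivity.HubbardSuperconductivity.Theses.ComplexGFFStiffness.closes HypACumulant_proof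
    HypALocalTwoPoint_proof

end Summit.HubbardSuperconductivity.HubbardSuperconductivity.Theorems

end
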